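import Literature.MathematicalPhysics.QuantumFieldTheory.Balaban1983to89.B8Thm4ExistsLocal

/-!
# `Balaban1983to89.B8Thm4TruncationLocal` — T. Bałaban, *Spaces of regular gauge field configurations on a lattice and gauge fixing
# conditions*, Commun. Math. Phys. **99** (1985) 75–102 [Balaban1985RegularSpaces] ("B8"), proof of THEOREM 4, p. 88: the INDUCTIVE
# BOOKKEEPING «It was already noticed that they imply the same conditions for k − 1 (we do not consider the set Ω_k). Applying the
# inductive hypothesis we get a gauge transformation u₁ such that (1.68) …» and p. 89 «They are satisfied in the case k = 1 also, if we
# take u₁ = 1, U′ = U₁» — the TRUNCATED DATUM (levels ≤ k − 1, with «Λ_{k−1} ∪ B(Λ_k) as Λ_{k−1}») on the concrete `ℤᵈ` carriers: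
# the typed classes restrict to it, its (1.29) IS (1.68), its towers sit inside the old ones, and the base datum `u₁ = 1`

statement-level skeleton of published theorems with citation tags; proofs where landed; nothing here is a claim about the
Yang–Mills mass gap

PDF held: `paper:balaban1985-cmp99-regular-spaces-gauge-fixing` (journal page = PDF page + 74); pp. 88–90 [PDF 14–16] read on the text layer by
this seat (2026-08-26).

WHAT IS PRINTED.  p. 88: "Thus let us assume that Theorem 4 holds for some `k − 1` and we will prove it for `k`. Let us take configurations
`U₀`, `U′U₀` satisfying the conditions (1.33), (1.34), (1.66). It was already noticed that they imply the same conditions for `k − 1` (we do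
not consider the set `Ω_k`). Applying the inductive hypothesis we get a gauge transformation `u₁` such that `(\overline{R₀u₁})^j(y) = 1` for
`y ∈ Λ_j`, `j = 0, 1, …, k − 2`, and for `y ∈ Λ_{k−1} ∪ B(Λ_k)`, `j = k − 1`, (1.68) `U₁ = U′^{u₁⁻¹} = e^{iηA}`, `|A| < B₁(α₀ + α₁)(Lʲη)⁻¹`, … on
`Ω_j`, `j = 0, 1, …, k − 1`. (1.69)"; p. 89, after (1.74): "(we take `Λ_{k−1} ∪ B(Λ_k)` as `Λ_{k−1}`). … They [(1.69), (1.73), (1.74)] are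
satisfied in the case `k = 1` also, if we take `u₁ = 1`, `U′ = U₁`, because then by Lemma 1 we have `|U′₁ − 1| < 4d²α₀ + α₁` and
`U₁ = e^{iA′} = e^{iL⁻¹A}` with `A` satisfying the bounds (1.69), at least for `B₁` not too small"; p. 90: "`u₁` satisfies (1.68). Of course
`(\overline{R₀u₁}{}^{k−1})(x) = 1` for `x ∈ B(Λ_k)` implies `(\overline{R₀u₁}{}^k)(y) = 1` for `y ∈ Λ_k`, hence `u₁` satisfies the conditions (1.29)".

WHY THIS FILE (the N05 KNIT seat; the `ind_of : T4e k → P3 k → Ind (k + 1)` / `base : Ind 1` leaves of `B8.Thm4SkeletonR` at the concrete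
level).  The siblings `B8Thm4ExistsLocal` (existence step at a level, given the inductive datum and Proposition 5's existence clause) and
`B8Thm4UniqueLocal` (uniqueness clause, given (1.109)) are this seat's knits of the two halves of Theorem 4 on the concrete carriers.  The
INDUCTION over the number of levels needs, between two steps, exactly the bookkeeping typed here: (a) the level-`(k+1)` typed hypotheses —
`B8Ineq132.InAk` ((1.7)/(1.33), (1.34) small-field part), `B8Eq119TwistedAxial.InAx` ((1.19)/(1.34) axial part) — RESTRICT to the truncated
datum with `k` levels whose top constraint set is «`Λ_k ∪ B(Λ_{k+1})` as `Λ_k`» (print, with its `k` written `k + 1`); (b) the level-`k`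
theorem's output (1.29) FOR THE TRUNCATED DATUM is literally r05's typed (1.68) `B8Eq178Averages.Cond168` — so the next step's Proposition 5
receives `u₁` exactly «satisfying (1.68)» (and (1.29) at `k + 1` levels by `B8Eq178Averages.restr129_of_cond168`); (c) the TOWERS of the truncated
datum (`Bᵏ(x)`, `x ∈ B(y)`, `y ∈ Λ_{k+1}`) lie inside the old towers `B^{k+1}(y)`, so every tower-local regularity hypothesis ((1.33), (1.34) as
`pdevOn` bounds, the currency of `B8Eq1112Local` / `B8Eq106Local` / this seat's knits) restricts, with the weaker scale `L^{−k} ≥ L^{−(k+1)}`;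
(d) the BASE datum «`u₁ = 1`, `U′ = U₁`»: `U′ = e^{iηA₀}` bondwise with `A₀ = (1/iη) log U′`, self-adjoint, `‖A₀_b‖ ≤ 2aη⁻¹` wherever
`‖U′_b − 1‖ ≤ a ≤ 1/4` (print takes this smallness from (1.66) at level `0`, `Ũ′⁰ = U′`, resp. Lemma 1), and `u₁ = 1` satisfies (1.29)/(1.68) at
every level.  The truncated constraint sets enter ONLY through two hypotheses on an arbitrary `Λ′ : ℕ → Set (Site d)` (`Λ′_j = Λ_j` for
`j < k`, `Λ′_k = Λ_k ∪ B(Λ_{k+1})`) — no definition is introduced, the family of record chooses its representation.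

WHAT THIS FILE PROVES (kernel, 0 sorry, theorems only, no `def`; carriers and conventions of the siblings; `B(y)` = the level-`k` block under the
level-`(k+1)` site `y` = `QuantumLattice.blockSites L y` as in `Cond168` = `{x : Under L 1 y x}`).
* §1 `under_one_of_mem_blockSites` / `mem_blockSites_of_under_one` (the two spellings of `x ∈ B(y)`); **`inAx_truncate`** — (1.19)/(1.34) for
  `k + 1` levels and `Λ` ⇒ the same for `k` levels and `Λ′` («they imply the same conditions for k − 1»; the new top sites `x ∈ B(Λ_{k+1})` inherit
  their axial conditions from the tower under `y`, `B8Eq131Derivation.under_succ_of_under_block`); `inAk_truncate` — (1.7)/(1.33) likewise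
  (drop the level); **`restr129_truncate_iff_cond168`** — (1.29) for the truncated datum ⟺ (1.68) (`Cond168`), for any gauge transformation;
  `restr129_one`, `cond168_one` — `u₁ = 1` satisfies both.
* §2 `tower_sub_of_under_one` — `Bᵏ(x) ⊆ B^{k+1}(y)` for `x ∈ B(y)` (as boxes of fine sites); `pdevOn_mono` — (1.7) on a box bounds (1.7) on a
  sub-box; **`pdevOn_truncate`** — a tower-local regularity bound `pdevOn (B^{k+1}(y)) V < αL^{−2(k+1)}` gives `pdevOn (Bᵏ(x)) V < αL^{−2k}` for
  the truncated datum's tower.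
* §3 **`base_datum`** — the base «`u₁ = 1`, `U′ = U₁`»: `mgauge U₀ 1 U′ = U′`, and at every bond `b` with `‖U′_b − 1‖ ≤ a ≤ 1/4` (`U′` unitary-
  valued): `U′_b = e^{iηA₀_b}`, `A₀_b := (1/iη) log U′_b` self-adjoint, `‖A₀_b‖ ≤ 2a·η⁻¹` (`MatrixLog.exp_mlog` / `norm_mlog_le_two_mul`,
  `B7Prop2Explicit.star_mlog_eq_neg`).

READINGS / DECLARED DEVIATIONS.  (i) Index shift as in `Cond168`: print's `k − 1 ↦ k`, `k ↦ k + 1` (no truncated subtraction).  (ii) `Λ′`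
hypothetical (two clauses), not defined.  (iii) The base bound `‖A₀‖ ≤ 2aη⁻¹` is the elementary logarithm estimate from `‖U′ − 1‖ ≤ a`; print's
«by Lemma 1 … 4d²α₀ + α₁» / (1.66)₀ supply `a` — NOT re-derived here (Lemma 1 on these carriers is `B8Lemma1NonAbelian`); the gradient member of
(1.69) at the base is not typed (it is consumed only inside Proposition 5).  NOT CLAIMED: Theorem 4 at any level, Propositions 3/5, the induction
itself (its sockets are recorded in the seat's design note); nothing of the node N05 is discharged by this file.  Unit `pub-ymgap-dag-n05-a` (g3),
2026-08-26.  Tree API by name only, nothing restated.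
-/

noncomputable section

open NormedSpace

namespace Literature.MathematicalPhysics.QuantumFieldTheory.Balaban1983to89.B8Thm4TruncationLocal

open Complex (I I_ne_zero)
open MatrixLog B7Prop1Explicit B7Prop2Explicit B7Prop1Local B7Eq92Concrete B7Eq84Concrete
open B8Ineq130 (tlo thi)
open B8Ineq132 (Under InAk)
open B8Eq119TwistedAxial (InAx Restr129)
open B8Eq131Derivation (under_succ_of_under_block under_one_block)
open B8Eq178Averages (Cond168 restr129_iff_uavg)
open B8Eq106Local (under_iff_tower)
open B8Eq184Proof (cfgExp)
open Literature.MathematicalPhysics.QuantumLattice (blockBase blockSites)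

-- `Site` alone could resolve to the torus sites of `Setup.lean`; re-export the `ℤ^d` sites of `B7Prop1Explicit`.
export B7Prop1Explicit (Site)

variable {d : ℕ}

/-! ## §1 The truncated datum: typed classes restrict; its (1.29) is (1.68) -/

section Blocks

/-- `x ∈ B(y)` (the level-`k` block under the level-`(k+1)` site `y`, `QuantumLattice.blockSites L y = {Ly + t : t ∈ [0,L)ᵈ}`) ⇒
`B8Ineq132.Under L 1 y x` (`B8Eq131Derivation.under_one_block`) — the block `B(y)` of (1.4)/(1.5) in the two tree spellings.
[cite: Balaban1985RegularSpaces, (1.4)–(1.5) p.77; Balaban1985Averaging, (78) p.30] -/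
theorem under_one_of_mem_blockSites {L : ℕ} {y x : Site d} (hx : x ∈ blockSites L y) : Under L 1 y x := by
  simp only [blockSites, Finset.mem_image, Fintype.mem_piFinset, Finset.mem_range] at hx
  obtain ⟨t, ht, rfl⟩ := hx
  have h := under_one_block L y (fun κ => (⟨t κ, ht κ⟩ : Fin L))
  have he : (L : ℤ) • y + boxVec L (fun κ => (⟨t κ, ht κ⟩ : Fin L)) = blockBase L y + fun i => (t i : ℤ) := by
    funext i
    simp [boxVec, blockBase]
  rwa [he] at h

/-- `B8Ineq132.Under L 1 y x` ⇒ `x ∈ B(y)` (`QuantumLattice.blockSites`) — the block `B(y)` of (1.4)/(1.5) in the two tree spellings.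
[cite: Balaban1985RegularSpaces, (1.4)–(1.5) p.77; Balaban1985Averaging, (78) p.30] -/
theorem mem_blockSites_of_under_one {L : ℕ} {y x : Site d} (hx : Under L 1 y x) : x ∈ blockSites L y := by
  simp only [blockSites, Finset.mem_image, Fintype.mem_piFinset, Finset.mem_range]
  have hnn : ∀ i, 0 ≤ x i - (L : ℤ) * y i := fun i => by have := (hx i).1; rw [pow_one] at this; linarith
  have hlt : ∀ i, x i - (L : ℤ) * y i < L := fun i => by have := (hx i).2; rw [pow_one] at this; linarith
  refine ⟨fun i => (x i - (L : ℤ) * y i).toNat, fun i => ?_, ?_⟩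
  · show (x i - (L : ℤ) * y i).toNat < L
    have h1 := Int.toNat_of_nonneg (hnn i)
    have h2 := hlt i
    omega
  · funext i
    simp only [blockBase, Pi.add_apply, Int.toNat_of_nonneg (hnn i)]
    ring

end Blocks

section Classes

variable {𝔸 : Type*} [NormedRing 𝔸] [NormedAlgebra ℂ 𝔸] [CompleteSpace 𝔸]
variable {L k : ℕ} {Λ Λ' : ℕ → Set (Site d)}

/-- **«they imply the same conditions for k − 1»: the AXIAL GAUGE CLASS RESTRICTS TO THE TRUNCATED DATUM.**  If `W ∈ Ax_{k+1}(𝔅_{k+1}, U₀)`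
for the constraint sets `Λ` ((1.19)/(1.34), `InAx L (k+1) Λ U₀ W`), then `W ∈ Ax_k(𝔅′_k, U₀)` for the truncated datum `Λ′` — `Λ′_j = Λ_j`
(`j < k`), `Λ′_k = Λ_k ∪ B(Λ_{k+1})` («we take Λ_{k−1} ∪ B(Λ_k) as Λ_{k−1}»): the axial conditions under a new top site `x ∈ B(y)`,
`y ∈ Λ_{k+1}`, are among those under `y` (`Bᵐ(x) ⊂ B^{m+1}(y)`). [cite: Balaban1985RegularSpaces, p.88 ("they imply the same conditions for k − 1"), p.89 ("we take Λ_{k−1} ∪ B(Λ_k) as Λ_{k−1}"), (1.19) p.79, (1.34) p.82] -/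
theorem inAx_truncate (hlt : ∀ j, j < k → Λ' j = Λ j) (hk : ∀ x, x ∈ Λ' k ↔ x ∈ Λ k ∨ ∃ y ∈ Λ (k + 1), x ∈ blockSites L y)
    {U₀ W : Site d → Fin d → 𝔸ˣ} (h : InAx L (k + 1) Λ U₀ W) : InAx L k Λ' U₀ W := by
  intro j hj1 hjk xj hxj n hn z hz r
  rcases Nat.lt_or_ge j k with hjlt | hjge
  · rw [hlt j hjlt] at hxj
    exact h j hj1 (by omega) xj hxj n hn z hz r
  · obtain rfl : j = k := le_antisymm hjk hjge
    rcases (hk xj).1 hxj with hx | ⟨y, hy, hxy⟩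
    · exact h j hj1 (by omega) xj hx n hn z hz r
    · -- `z ∈ B^{k−(n+1)}(x)`, `x ∈ B(y)` ⇒ `z ∈ B^{(k+1)−(n+1)}(y)`
      have hz' : Under L (j + 1 - (n + 1)) y z := by
        rw [show j + 1 - (n + 1) = (j - (n + 1)) + 1 by omega]
        exact under_succ_of_under_block (under_one_of_mem_blockSites hxy) hz
      exact h (j + 1) (by omega) le_rfl y hy n (by omega) z hz' r

omit [CompleteSpace 𝔸] in
/-- **The small-field class restricts** ((1.7)/(1.33), and (1.34)'s `𝔄`-part): `𝔄_{k+1}({Ω_j}, α) ⊂ 𝔄_k({Ω_j}_{j ≤ k}, α)` («we do not consider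
the set Ω_k»). [cite: Balaban1985RegularSpaces, p.88 ("we do not consider the set Ω_k"), (1.7) p.77, (1.33) p.82] -/
theorem inAk_truncate {η α : ℝ} {Ω : ℕ → Set (Site d)} {V : Site d → Fin d → 𝔸ˣ} (h : InAk L (k + 1) η α Ω V) : InAk L k η α Ω V :=
  fun j hj => h j (Nat.le_succ_of_le hj)

/-- **(1.29) FOR THE TRUNCATED DATUM IS (1.68)**: for every gauge transformation `u`, `Restr129 L k Λ′ U₀ u` (the level-`k` theorem's gauge
condition on `Λ′`, `Λ′_k = Λ_k ∪ B(Λ_{k+1})`) ⟺ `B8Eq178Averages.Cond168 L k Λ U₀ u` (r05's typed (1.68), print's `k` written `k + 1`) — so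
«Applying the inductive hypothesis we get a gauge transformation u₁ such that (1.68)». [cite: Balaban1985RegularSpaces, (1.68) p.88, (1.29) p.81, p.89 ("we take Λ_{k−1} ∪ B(Λ_k) as Λ_{k−1}")] -/
theorem restr129_truncate_iff_cond168 (hlt : ∀ j, j < k → Λ' j = Λ j)
    (hk : ∀ x, x ∈ Λ' k ↔ x ∈ Λ k ∨ ∃ y ∈ Λ (k + 1), x ∈ blockSites L y)
    (U₀ : Site d → Fin d → 𝔸ˣ) (u : Site d → 𝔸ˣ) : Restr129 L k Λ' U₀ u ↔ Cond168 L k Λ U₀ u := by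
  constructor
  · intro h
    refine ⟨fun j hj y hy => ?_, fun y hy => ?_, fun y hy x hx => ?_⟩
    · exact h j hj.le y (by rw [hlt j hj]; exact hy)
    · exact h k le_rfl y ((hk y).2 (Or.inl hy))
    · exact h k le_rfl x ((hk x).2 (Or.inr ⟨y, hy, hx⟩))
  · rintro ⟨h1, h2, h3⟩ j hj y hy
    rcases Nat.lt_or_ge j k with hjk | hjk
    · exact h1 j hjk y (by rw [← hlt j hjk]; exact hy)
    · obtain rfl : j = k := le_antisymm hj hjk
      rcases (hk y).1 hy with hy' | ⟨w, hw, hyw⟩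
      · exact h2 y hy'
      · exact h3 w hw y hyw

/-- `u₁ = 1` satisfies (1.29) at every level (all its averages are `1`, `B7Eq167Flat.uavg_one_right`) — the base «if we take u₁ = 1».
[cite: Balaban1985RegularSpaces, p.89 ("if we take u₁ = 1")] -/
theorem restr129_one [NormOneClass 𝔸] (L k : ℕ) (Λ : ℕ → Set (Site d)) (U₀ : Site d → Fin d → 𝔸ˣ) :
    Restr129 L k Λ U₀ (1 : Site d → 𝔸ˣ) := by
  rw [restr129_iff_uavg]
  intro j _ y _
  rw [B7Eq167Flat.uavg_one_right]
  rfl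

/-- `u₁ = 1` satisfies (1.68) (through `restr129_truncate_iff_cond168` with the truncation `Λ′` displayed). [cite: Balaban1985RegularSpaces, p.89 ("if we take u₁ = 1"), (1.68) p.88] -/
theorem cond168_one [NormOneClass 𝔸] (L k : ℕ) (Λ : ℕ → Set (Site d)) (U₀ : Site d → Fin d → 𝔸ˣ) :
    Cond168 L k Λ U₀ (1 : Site d → 𝔸ˣ) := by
  have h := restr129_one L k (fun j => if j < k then Λ j else {x | x ∈ Λ k ∨ ∃ y ∈ Λ (k + 1), x ∈ blockSites L y}) U₀
  exact (restr129_truncate_iff_cond168 (Λ := Λ) (fun j hj => by simp [hj]) (fun x => by simp) U₀ 1).1 h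

end Classes

/-! ## §2 The towers of the truncated datum sit inside the old towers -/

section Towers

variable {L k : ℕ}

/-- `x ∈ Bʲ(y)` in the two spellings (`InBox` of the tower corners ⟺ `Under`). [folklore] -/
private theorem inBox_iff_under (L j : ℕ) (y x : Site d) : InBox (tlo L y j) (thi L y j) x ↔ Under L j y x := by
  rw [under_iff_tower]
  exact ⟨fun h => ⟨fun i => (h i).1, fun i => (h i).2⟩, fun h i => ⟨h.1 i, h.2 i⟩⟩

/-- **`Bᵏ(x) ⊆ B^{k+1}(y)` for `x ∈ B(y)`** (fine sites; `B8Eq131Derivation.under_succ_of_under_block`). [cite: Balaban1985RegularSpaces, p.79 ("x_n ∈ B(x_{n+1})")] -/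
theorem tower_sub_of_under_one {y x : Site d} (hx : Under L 1 y x) {z : Site d} (hz : InBox (tlo L x k) (thi L x k) z) :
    InBox (tlo L y (k + 1)) (thi L y (k + 1)) z :=
  (inBox_iff_under L (k + 1) y z).2 (under_succ_of_under_block hx ((inBox_iff_under L k x z).1 hz))

variable {𝔸 : Type*} [NormedRing 𝔸] [NormOneClass 𝔸]

/-- **(1.7) ON A BOX BOUNDS (1.7) ON ANY SUB-BOX** (`pdevOn` is a supremum over the plaquettes inside the box). [cite: Balaban1985Averaging, (44) p.24] -/
theorem pdevOn_mono {lo hi lo' hi' : Site d} {V : Site d → Fin d → 𝔸ˣ} (hV : ∀ x κ, V x κ ∈ U1 𝔸)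
    (hsub : ∀ z, InBox lo' hi' z → InBox lo hi z) : pdevOn lo' hi' V ≤ pdevOn lo hi V := by
  refine Real.iSup_le (fun p => ?_) (pdevOn_nonneg lo hi V)
  exact le_pdevOn hV ⟨hsub _ p.2.1, hsub _ p.2.2⟩

/-- **A TOWER-LOCAL REGULARITY BOUND RESTRICTS TO THE TRUNCATED DATUM'S TOWER**: for `x ∈ B(y)` (`Under L 1 y x`), `U1`-valued `V`, `α ≥ 0`,
`L ≥ 1`: `pdevOn (B^{k+1}(y)) V < α·L^{−2(k+1)}` ⇒ `pdevOn (Bᵏ(x)) V < α·L^{−2k}` — the sub-box carries fewer plaquettes and the level-`k` threshold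
is the weaker one. [cite: Balaban1985RegularSpaces, p.88 ("they imply the same conditions for k − 1"), (1.33) p.82] -/
theorem pdevOn_truncate (hL1 : 1 ≤ L) {y x : Site d} (hx : Under L 1 y x) {V : Site d → Fin d → 𝔸ˣ} (hV : ∀ x κ, V x κ ∈ U1 𝔸)
    {α : ℝ} (hα : 0 ≤ α) (h : pdevOn (tlo L y (k + 1)) (thi L y (k + 1)) V < α * (((L : ℝ) ^ (k + 1))⁻¹) ^ 2) :
    pdevOn (tlo L x k) (thi L x k) V < α * (((L : ℝ) ^ k)⁻¹) ^ 2 := by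
  have hLr : (1 : ℝ) ≤ L := by exact_mod_cast hL1
  have hmono := pdevOn_mono hV (fun z hz => tower_sub_of_under_one (k := k) hx hz)
  refine (hmono.trans_lt h).trans_le (mul_le_mul_of_nonneg_left ?_ hα)
  have h1 : (0 : ℝ) < (L : ℝ) ^ k := by positivity
  have h2 : (L : ℝ) ^ k ≤ (L : ℝ) ^ (k + 1) := pow_le_pow_right₀ hLr (Nat.le_succ k)
  have h3 : ((L : ℝ) ^ (k + 1))⁻¹ ≤ ((L : ℝ) ^ k)⁻¹ := inv_anti₀ h1 h2
  exact pow_le_pow_left₀ (by positivity) h3 2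

end Towers

/-! ## §3 The base datum «u₁ = 1, U′ = U₁» -/

section Base

variable {𝔸 : Type*} [CStarAlgebra 𝔸]

/-- **THE BASE OF THE INDUCTION** («They are satisfied in the case k = 1 also, if we take u₁ = 1, U′ = U₁», p. 89): with `u₁ = 1` one has
`U₁ = U′^{1⁻¹} = U′` (`mgauge U₀ 1 U′ = U′`), and at every bond `b` where `‖U′_b − 1‖ ≤ a ≤ 1/4` (print: from (1.66) at level `0`, `Ũ′⁰ = U′`, resp.
Lemma 1) the bond variable is an exponential `U′_b = e^{iηA₀_b}` with `A₀_b := (1/iη) log U′_b` (`MatrixLog.exp_mlog`), self-adjoint for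
unitary-valued `U′` (`B7Prop2Explicit.star_mlog_eq_neg`), and `‖A₀_b‖ ≤ 2a·η⁻¹` (`MatrixLog.norm_mlog_le_two_mul`) — the first member of (1.69)
at the base in the bondwise currency of `B8Thm4ExistsLocal.thm4_exists_step_onBonds` (read `2aη⁻¹ = 2aLʲ·(Lʲη)⁻¹`). [cite: Balaban1985RegularSpaces, p.89 ("if we take u₁ = 1, U′ = U₁"), (1.69) p.88, (1.66) p.88] -/
theorem base_datum {η : ℝ} (hη : 0 < η) (U₀ U' : Site d → Fin d → 𝔸ˣ) (hU' : ∀ x κ, U' x κ ∈ unitaryUnits 𝔸) {a : ℝ} (ha : a ≤ 1 / 4)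
    (x : Site d) (κ : Fin d) (hb : ‖((U' x κ : 𝔸ˣ) : 𝔸) - 1‖ ≤ a) :
    mgauge U₀ (1 : Site d → 𝔸ˣ) U' = U' ∧
      U' x κ = cfgExp η (fun y μ => η⁻¹ • ((I⁻¹ : ℂ) • mlog ((U' y μ : 𝔸ˣ) : 𝔸))) x κ ∧
      IsSelfAdjoint (η⁻¹ • ((I⁻¹ : ℂ) • mlog ((U' x κ : 𝔸ˣ) : 𝔸))) ∧
      ‖η⁻¹ • ((I⁻¹ : ℂ) • mlog ((U' x κ : 𝔸ˣ) : 𝔸))‖ ≤ 2 * a * η⁻¹ := by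
  have hb4 : ‖((U' x κ : 𝔸ˣ) : 𝔸) - 1‖ ≤ 1 / 4 := hb.trans ha
  refine ⟨?_, ?_, ?_, ?_⟩
  · funext z μ
    simp [mgauge_apply]
  · -- `e^{iηA₀_b} = e^{log U′_b} = U′_b`
    have harg : (I : ℂ) • (η • (η⁻¹ • ((I⁻¹ : ℂ) • mlog ((U' x κ : 𝔸ˣ) : 𝔸)))) = mlog ((U' x κ : 𝔸ˣ) : 𝔸) := by
      rw [smul_smul η η⁻¹, mul_inv_cancel₀ hη.ne', one_smul, smul_smul, mul_inv_cancel₀ I_ne_zero, one_smul]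
    apply Units.ext
    show _ = exp ((I : ℂ) • (η • (η⁻¹ • ((I⁻¹ : ℂ) • mlog ((U' x κ : 𝔸ˣ) : 𝔸)))))
    rw [harg]
    exact (exp_mlog (hb4.trans_lt (by norm_num))).symm
  · show star (η⁻¹ • ((I⁻¹ : ℂ) • mlog ((U' x κ : 𝔸ˣ) : 𝔸))) = _
    rw [star_smul, star_smul, star_mlog_eq_neg (mem_unitaryUnits.1 (hU' x κ)) hb4, Complex.inv_I, Complex.star_def, map_neg,
      Complex.conj_I, neg_neg, smul_neg, neg_smul, star_trivial]
  · have hlog := norm_mlog_le_two_mul (hb4.trans (by norm_num))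
    rw [norm_smul, norm_smul, norm_inv, norm_inv, Complex.norm_I, inv_one, one_mul, Real.norm_eq_abs, abs_of_pos hη, mul_comm]
    calc ‖mlog ((U' x κ : 𝔸ˣ) : 𝔸)‖ * η⁻¹ ≤ (2 * ‖((U' x κ : 𝔸ˣ) : 𝔸) - 1‖) * η⁻¹ :=
          mul_le_mul_of_nonneg_right hlog (inv_nonneg.mpr hη.le)
      _ ≤ 2 * a * η⁻¹ := by
          refine mul_le_mul_of_nonneg_right ?_ (inv_nonneg.mpr hη.le)
          linarith

end Base

end Literature.MathematicalPhysics.QuantumFieldTheory.Balaban1983to89.B8Thm4TruncationLocal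

end
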